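import Literature.Computability.Complexity.Classes
import Literature.Computability.Complexity.TimeBoundsProofs

/-!
# Route CompactnessLift · crux `CompactnessPrinciple` (stmt-QuantumAdvantage-15270), line
`universal-clock-padding`: stub `stub_preimage`

Generic closure fact used by the line: the preimage `{W | ρ W ∈ U}` of a language
`U ∈ DTIME(n^d)` under a LINEAR-time instance map `ρ` lies in `DTIME(n^{max d 1})`.
Machine: the sequential composite `M₁.comp M₂` of a machine `M₁` for `ρ` (time `a n + a`) and a
decider `M₂` for `U` (time `c n^d + c`), with additive running time
(`Turing.TM2ComputableAux.comp_outputsWithin`); the intermediate word has length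
`≤ n + D (a n + a)` (`OutputsWithin.length_le`, `D = machinePushBound M₁.tm`), and the exponent
`max d 1` absorbs the degenerate slice `d = 0`, where the composite time is linear, not constant.
-/

set_option linter.dupNamespace false
-- the Summit.QuantumAdvantage.QuantumAdvantage.… namespace repeats summit = sub-problem (D-0017 layout)

namespace Summit.QuantumAdvantage.QuantumAdvantage.Theorems

open Literature.Computability.Complexity
open _root_.Computability (encodeBool)

/-- `(n + 1)^d ≤ 2^d n^{max d 1} + 2^d`: for `d = 0` both sides are `1 ≤ n + 1`; for `d ≥ 1` and
`n ≥ 1`, `n + 1 ≤ 2 n`; for `n = 0` the left side is `1 ≤ 2^d`. -/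
theorem succ_pow_le_two_pow_mul_pow_max (n d : ℕ) :
    (n + 1) ^ d ≤ 2 ^ d * n ^ max d 1 + 2 ^ d := by
  rcases d with _ | d
  · rw [pow_zero, pow_zero, one_mul]
    exact Nat.le_add_left 1 _
  · have hmax : max (d + 1) 1 = d + 1 := max_eq_left (Nat.succ_le_succ (Nat.zero_le d))
    rw [hmax]
    rcases n with _ | n
    · rw [zero_add, one_pow]
      exact le_add_of_nonneg_of_le (Nat.zero_le _) Nat.one_le_two_pow
    · calc (n + 1 + 1) ^ (d + 1) ≤ (2 * (n + 1)) ^ (d + 1) := Nat.pow_le_pow_left (by omega) _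
        _ = 2 ^ (d + 1) * (n + 1) ^ (d + 1) := Nat.mul_pow 2 (n + 1) (d + 1)
        _ ≤ 2 ^ (d + 1) * (n + 1) ^ (d + 1) + 2 ^ (d + 1) := Nat.le_add_right _ _

/-- The arithmetic of the per-input time bound of the composite decider: if the intermediate
word has length `m ≤ n + D (a n + a)`, then `c m^d + c + (a n + a) ≤ C n^{max d 1} + C` with
`C = c (1 + D a)^d 2^d + c + a`. -/
theorem preimage_time_bound (a c D d n m : ℕ) (hm : m ≤ n + D * (a * n + a)) :
    c * m ^ d + c + (a * n + a) ≤
      (c * ((1 + D * a) ^ d * 2 ^ d) + c + a) * n ^ max d 1 +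
        (c * ((1 + D * a) ^ d * 2 ^ d) + c + a) := by
  have he : max d 1 ≠ 0 := Nat.one_le_iff_ne_zero.mp (le_max_right d 1)
  have hK : (1 + D * a) * (n + 1) = n + D * (a * n + a) + 1 := by ring
  have hmK : m ≤ (1 + D * a) * (n + 1) := by omega
  have hpow : m ^ d ≤ (1 + D * a) ^ d * (2 ^ d * n ^ max d 1 + 2 ^ d) :=
    calc m ^ d ≤ ((1 + D * a) * (n + 1)) ^ d := Nat.pow_le_pow_left hmK d
      _ = (1 + D * a) ^ d * (n + 1) ^ d := Nat.mul_pow _ _ _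
      _ ≤ (1 + D * a) ^ d * (2 ^ d * n ^ max d 1 + 2 ^ d) :=
          Nat.mul_le_mul_left _ (succ_pow_le_two_pow_mul_pow_max n d)
  have h1 : c * m ^ d ≤ c * ((1 + D * a) ^ d * (2 ^ d * n ^ max d 1 + 2 ^ d)) :=
    Nat.mul_le_mul_left c hpow
  have h2 : a * n ≤ a * n ^ max d 1 := Nat.mul_le_mul_left a (Nat.le_self_pow he n)
  have expand : (c * ((1 + D * a) ^ d * 2 ^ d) + c + a) * n ^ max d 1 +
      (c * ((1 + D * a) ^ d * 2 ^ d) + c + a) =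
      c * ((1 + D * a) ^ d * (2 ^ d * n ^ max d 1 + 2 ^ d)) + a * n ^ max d 1 +
        (c * n ^ max d 1 + c + a) := by
    ring
  rw [expand]
  omega

/-- **Linear-time preimages of `DTIME(n^d)` languages.** If `U ∈ DTIME(n^d)` and the instance
map `ρ` is computable in time `a n + a`, then `{W | ρ W ∈ U} ∈ DTIME(n^{max d 1})`: run a machine
for `ρ`, then a decider for `U` on its output, in place (`Turing.TM2ComputableAux.comp`, additive
time `(c m^d + c) + (a n + a)` with `m = |ρ W| ≤ n + D (a n + a)` by `OutputsWithin.length_le`);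
the indicator of the preimage at `W` is the indicator of `U` at `ρ W` by `rfl`.
[Arora–Barak 2009, §1.3 (machine composition)] -/
theorem stub_preimage {U : Language Bool} {d : ℕ} (hU : U ∈ DTIME fun n => n ^ d)
    {ρ : List Bool → List Bool} {a : ℕ} (hρ : TimeComputable id id ρ fun n => a * n + a) :
    {W : List Bool | ρ W ∈ U} ∈ DTIME fun n => n ^ max d 1 := by
  obtain ⟨c, M₂, hM₂⟩ := hU
  obtain ⟨M₁, hM₁⟩ := hρ
  refine ⟨c * ((1 + TM2Comp.machinePushBound M₁.tm * a) ^ d * 2 ^ d) + c + a, M₁.comp M₂,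
    fun W => ?_⟩
  have e₁ : M₁.OutputsWithin W (ρ W) (a * W.length + a) := hM₁ W
  have e₂ : M₂.OutputsWithin (ρ W) (encodeBool (U.boolIndicator (ρ W)))
      (c * (ρ W).length ^ d + c) := hM₂ _
  have e := Turing.TM2ComputableAux.comp_outputsWithin _ _ e₁ e₂
  have hind : Set.boolIndicator {W : List Bool | ρ W ∈ U} W = U.boolIndicator (ρ W) := rfl
  show (M₁.comp M₂).OutputsWithin W (encodeBool (Set.boolIndicator {W : List Bool | ρ W ∈ U} W))
    ((c * ((1 + TM2Comp.machinePushBound M₁.tm * a) ^ d * 2 ^ d) + c + a) * W.length ^ max d 1 +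
      (c * ((1 + TM2Comp.machinePushBound M₁.tm * a) ^ d * 2 ^ d) + c + a))
  rw [hind]
  exact e.mono (preimage_time_bound a c (TM2Comp.machinePushBound M₁.tm) d W.length (ρ W).length
    e₁.length_le)

end Summit.QuantumAdvantage.QuantumAdvantage.Theorems
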